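import Summits.PneNP.PneNP.Theorems.ConvexRankGatesLinAlgGateBlindDefs

/-!
# Route ConvexRankGates, crux `LinAlgGateBlind` (stmt-PneNP-10681): visibly rigid span programs satisfy SG

Support lemma for the research stub `stub_sgPerm` (lines `dnf-invariant-wide-gates-see-small-cliques`,
`konig-atoms-cancellation-split`), vocabulary of `Theorems/ConvexRankGatesLinAlgGateBlindDefs.lean`.
Companion of `Theorems/ConvexRankGatesLinAlgGateBlindRigidSpanProgram.lean` (coordinate-free pairwise rigidity);
this file is the COORDINATE version with VISIBILITY, which also covers span programs whose unknowns sit on PAIRS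
(the first non-rigid case of that file).

Setting. A span-program term gate in equation form: unknowns indexed by a finite type `ι`, one equation
`⟨c X, z⟩ = b X` per clique atom `X ∈ 𝒱(l)` over a field `F`; the gate accepts `x` iff the equations of the
present atoms are inconsistent, i.e. iff `t := (0, 1) ∈ W(x) := span_F {(c X, b X) : X ∈ 𝒱(l), ⌈X⌉(x)}`.
A VISIBILITY predicate `Vis x i` ("coordinate `i` is seen in the graph `x`") is linked to the rows by LOCALITY:
a present atom only uses visible coordinates (`⌈X⌉(x) → c X i ≠ 0 → Vis x i`). Examples: unknowns on vertices,
`Vis = True`; unknowns on pairs `e : KEdge m` with `c X e = 0` unless `e ⊆ X`, `Vis x e := (x e = true)`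
(`sg_of_pairLocalSpanProgram`).

**Theorem (`sg_of_visiblyRigidSpanProgram`).** Let `P` be any graph property with PAIRWISE VISIBLE RIGIDITY:
for `P`-graphs `G, G'` and every coordinate `i` visible in both, `(e_i, 0) ∈ span {rows present in both} ⊔ F∙t`.
Then some `𝒜 ⊆ 𝒱(l)` has `lostPos m k O 𝒜 = ∅` and `gainedNeg m q O 𝒜 ≤ Pr_{G(m,q)}[¬P]`.

Proof. A rejected `P`-graph `G` (`t ∉ W(G)`) carries a linear functional `φ_G` with `φ_G t = 1`, `φ_G(W G) = 0`
(Mathlib `Submodule.exists_dual_map_eq_bot_of_notMem`). AGREEMENT: for rejected `P`-graphs `G₁, G₂` both seeing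
`i`, rigidity writes `(e_i,0) = u + a•t` with `u ∈ W G₁ ⊓ W G₂`, so `φ_{G₁}(e_i,0) = a = φ_{G₂}(e_i,0)`. Hence
there is ONE vector `θ : ι → F` with `θ i = φ_G(e_i, 0)` whenever `G` is a rejected `P`-graph seeing `i`, and the
functional `ψ(c, β) := β + Σ_i c_i θ_i` kills every row present in ANY rejected `P`-graph (expand `φ_G (c X, b X)`
over the coordinates with `c X i ≠ 0`, all visible by locality) while `ψ t = 1`. With `H := ker ψ ∌ t` and
`𝒜 := {X ∈ 𝒱(l) : (c X, b X) ∉ H}`: an accepted bare clique has a present row outside `H` (else `t ∈ W ≤ H`), and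
a rejected `P`-graph presents no atom of `𝒜`. ∎  In words: all typical rejected graphs are explained by ONE global
assignment `z = -θ` (every present equation holds at `z`), and `𝒜` = the atoms whose equation fails at `z`.
So a span-program violator of `stub_sgPerm` needs coordinates that typical pairs of graphs both see but whose
unit vectors the commonly present atoms do not generate modulo `t`.

No new definitions. [folklore]
-/

-- `Summit.PneNP.PneNP.…` duplicates `PneNP` BY DESIGN (single-problem summit).
set_option linter.dupNamespace false

namespace Summit.PneNP.PneNP.Theorems

open Finset Literature.Computability.Complexity Razborov
open Summit.PneNP.PneNP.Cruxes.LinAlgGateBlind.DnfInvariantWideGatesSeeSmallCliques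

/-- **Main lemma (one `t`-avoiding subspace explains SG).** If a subspace `H ∌ t` contains the present-row span of
every rejected `P`-graph, then `𝒜 = {X ∈ 𝒱(l) : r X ∉ H}` loses no accepted bare clique and is silent on rejected
`P`-graphs, so `lostPos = ∅` and `gainedNeg ≤ Pr[¬P]`. [folklore] -/
theorem sg_of_avoiding_subspace {m l k : ℕ} {q : ℝ} (hq0 : 0 ≤ q) (hq1 : q ≤ 1) {F V : Type}
    [DivisionRing F] [AddCommGroup V] [Module F V] (r : Finset (Fin m) → V) (t : V)
    (O : (KEdge m → Bool) → Bool)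
    (hO : ∀ x, O x = true ↔
      t ∈ Submodule.span F (r '' {X | X ∈ smallSets (Fin m) l ∧ CliquePresent X x}))
    (P : (KEdge m → Bool) → Prop) (H : Submodule F V) (htH : t ∉ H)
    (hH : ∀ G, P G → O G = false → ∀ X ∈ smallSets (Fin m) l, CliquePresent X G → r X ∈ H) :
    ∃ 𝒜 ⊆ smallSets (Fin m) l, lostPos m k O 𝒜 = ∅ ∧ gainedNeg m q O 𝒜 ≤ prob q (fun G => ¬ P G) := by
  classical
  refine ⟨(smallSets (Fin m) l).filter fun X => r X ∉ H, filter_subset _ _, ?_, ?_⟩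
  · refine filter_eq_empty_iff.2 fun S _ h => ?_
    obtain ⟨hS, hacc⟩ := h
    have htS := (hO _).1 hS
    have hle : Submodule.span F (r '' {X | X ∈ smallSets (Fin m) l ∧ CliquePresent X (cliqueVec S)}) ≤ H := by
      refine Submodule.span_le.2 ?_
      rintro _ ⟨X, ⟨hX, hXS⟩, rfl⟩
      by_contra hXH
      exact hacc ⟨X, mem_filter.2 ⟨hX, hXH⟩, hXS⟩
    exact htH (hle htS)
  · refine prob_mono hq0 hq1 fun G hG hPG => ?_
    obtain ⟨hOG, X, hX𝒜, hXG⟩ := hG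
    obtain ⟨hX, hXH⟩ := mem_filter.1 hX𝒜
    exact hXH (hH G hPG hOG X hX hXG)

/-- A rejected graph carries a linear functional normalised at the target and killing the present rows
(Hahn–Banach-free: `Submodule.exists_dual_map_eq_bot_of_notMem` over a field). [folklore] -/
theorem exists_dual_eq_one_of_notMem {F V : Type} [Field F] [AddCommGroup V] [Module F V]
    (W : Submodule F V) {t : V} (ht : t ∉ W) :
    ∃ φ : Module.Dual F V, φ t = 1 ∧ ∀ w ∈ W, φ w = 0 := by
  obtain ⟨f, hft, hfW⟩ := W.exists_dual_map_eq_bot_of_notMem ht inferInstance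
  refine ⟨(f t)⁻¹ • f, ?_, fun w hw => ?_⟩
  · rw [LinearMap.smul_apply, smul_eq_mul, inv_mul_cancel₀ hft]
  · have : f w ∈ W.map f := Submodule.mem_map_of_mem hw
    rw [hfW, Submodule.mem_bot] at this
    rw [LinearMap.smul_apply, this, smul_zero]

/-- **Visibly rigid span-program term gates satisfy SG (support lemma for `stub_sgPerm`, stmt-PneNP-10681).**
Equation form over a field `F` with unknowns indexed by `ι`: rows `(c X, b X)`, target `(0,1)`, a visibility
predicate `Vis` with locality (`⌈X⌉(x) → c X i ≠ 0 → Vis x i`), and any graph property `P` with pairwise visible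
rigidity (`(e_i, 0)` is generated, modulo the target, by the rows present in both of two `P`-graphs that both see
`i`). Then some `𝒜 ⊆ 𝒱(l)` has `lostPos m k O 𝒜 = ∅ ∧ gainedNeg m q O 𝒜 ≤ prob q ¬P`. [folklore] -/
theorem sg_of_visiblyRigidSpanProgram :
    ∀ (m l k : ℕ) (q : ℝ), 0 ≤ q → q ≤ 1 →
    ∀ {F ι : Type} [Field F] [Fintype ι] [DecidableEq ι]
      (c : Finset (Fin m) → ι → F) (b : Finset (Fin m) → F) (O : (KEdge m → Bool) → Bool),
      (∀ x, O x = true ↔ ((0 : ι → F), (1 : F)) ∈ Submodule.span F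
        ((fun X : Finset (Fin m) => (c X, b X)) '' {X | X ∈ smallSets (Fin m) l ∧ CliquePresent X x})) →
    ∀ (Vis : (KEdge m → Bool) → ι → Prop),
      (∀ (x : KEdge m → Bool) (X : Finset (Fin m)) (i : ι),
        X ∈ smallSets (Fin m) l → CliquePresent X x → c X i ≠ 0 → Vis x i) →
    ∀ (P : (KEdge m → Bool) → Prop),
      (∀ G G', P G → P G' → ∀ i, Vis G i → Vis G' i →
        ((Pi.single i (1 : F) : ι → F), (0 : F)) ∈ Submodule.span F
            ((fun X : Finset (Fin m) => (c X, b X)) ''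
              {Y | Y ∈ smallSets (Fin m) l ∧ CliquePresent Y G ∧ CliquePresent Y G'})
          ⊔ Submodule.span F {((0 : ι → F), (1 : F))}) →
      ∃ 𝒜 ⊆ smallSets (Fin m) l,
        lostPos m k O 𝒜 = ∅ ∧ gainedNeg m q O 𝒜 ≤ prob q (fun G => ¬ P G) := by
  intro m l k q hq0 hq1 F ι _ _ _ c b O hO Vis hVis P hrigid
  classical
  set r : Finset (Fin m) → (ι → F) × F := fun X => (c X, b X) with hr
  set t : (ι → F) × F := ((0 : ι → F), (1 : F)) with ht
  set W : (KEdge m → Bool) → Submodule F ((ι → F) × F) := fun x =>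
    Submodule.span F (r '' {X | X ∈ smallSets (Fin m) l ∧ CliquePresent X x}) with hW
  have hOW : ∀ x, O x = false → t ∉ W x := fun x hx htx => by
    have := (hO x).2 htx
    rw [hx] at this
    exact Bool.false_ne_true this
  -- Step 1: a normalised functional per rejected graph
  have hex : ∀ G, ∃ φ : Module.Dual F ((ι → F) × F),
      O G = false → (φ t = 1 ∧ ∀ w ∈ W G, φ w = 0) := by
    intro G
    by_cases hG : O G = false
    · obtain ⟨φ, h1, h2⟩ := exists_dual_eq_one_of_notMem (W G) (hOW G hG)
      exact ⟨φ, fun _ => ⟨h1, h2⟩⟩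
    · exact ⟨0, fun h => absurd h hG⟩
  choose Φ hΦ using hex
  -- Step 2: agreement of the functionals on commonly visible coordinates
  have hagree : ∀ G₁ G₂, P G₁ → P G₂ → O G₁ = false → O G₂ = false → ∀ i, Vis G₁ i → Vis G₂ i →
      Φ G₁ (Pi.single i 1, 0) = Φ G₂ (Pi.single i 1, 0) := by
    intro G₁ G₂ hP₁ hP₂ hO₁ hO₂ i hi₁ hi₂
    have hmem := hrigid G₁ G₂ hP₁ hP₂ i hi₁ hi₂
    rw [Submodule.mem_sup] at hmem
    obtain ⟨u, hu, z, hz, huz⟩ := hmem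
    obtain ⟨a, rfl⟩ := Submodule.mem_span_singleton.1 hz
    have hboth : Submodule.span F (r '' {Y | Y ∈ smallSets (Fin m) l ∧ CliquePresent Y G₁ ∧
        CliquePresent Y G₂}) ≤ W G₁ ⊓ W G₂ := by
      refine Submodule.span_le.2 ?_
      rintro _ ⟨Y, ⟨hY, hY₁, hY₂⟩, rfl⟩
      exact ⟨Submodule.subset_span ⟨Y, ⟨hY, hY₁⟩, rfl⟩, Submodule.subset_span ⟨Y, ⟨hY, hY₂⟩, rfl⟩⟩
    have h1 : Φ G₁ (Pi.single i 1, 0) = a := by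
      rw [← huz, map_add, (hΦ G₁ hO₁).2 u (hboth hu).1, map_smul, (hΦ G₁ hO₁).1, smul_eq_mul, mul_one,
        zero_add]
    have h2 : Φ G₂ (Pi.single i 1, 0) = a := by
      rw [← huz, map_add, (hΦ G₂ hO₂).2 u (hboth hu).2, map_smul, (hΦ G₂ hO₂).1, smul_eq_mul, mul_one,
        zero_add]
    rw [h1, h2]
  -- Step 3: one global vector of coordinate values
  have hθ : ∀ i, ∃ θi : F, ∀ G, P G → O G = false → Vis G i → θi = Φ G (Pi.single i 1, 0) := by
    intro i
    by_cases h : ∃ G₀, P G₀ ∧ O G₀ = false ∧ Vis G₀ i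
    · obtain ⟨G₀, hP₀, hO₀, hi₀⟩ := h
      exact ⟨Φ G₀ (Pi.single i 1, 0), fun G hP hOG hi => hagree G₀ G hP₀ hP hO₀ hOG i hi₀ hi⟩
    · push Not at h
      exact ⟨0, fun G hP hOG hi => absurd hi (h G hP hOG)⟩
  choose θ hθ using hθ
  -- Step 4: the global functional `ψ (v, β) = β + Σ_i v i * θ i` and its kernel
  let ψ : ((ι → F) × F) →ₗ[F] F :=
    { toFun := fun v => v.2 + ∑ i, v.1 i * θ i
      map_add' := fun v w => by
        simp only [Prod.snd_add, Prod.fst_add, Pi.add_apply, add_mul, sum_add_distrib]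
        abel
      map_smul' := fun a v => by
        simp only [Prod.smul_snd, Prod.smul_fst, Pi.smul_apply, smul_eq_mul, RingHom.id_apply, mul_add,
          mul_sum, mul_assoc] }
  have hψ_apply : ∀ v : (ι → F) × F, ψ v = v.2 + ∑ i, v.1 i * θ i := fun v => rfl
  have hψt : ψ t = 1 := by
    rw [hψ_apply, ht]
    simp
  -- every row present in a rejected `P`-graph is killed by `ψ`
  have hkill : ∀ G, P G → O G = false → ∀ X ∈ smallSets (Fin m) l, CliquePresent X G → ψ (r X) = 0 := by
    intro G hPG hOG X hX hXG
    have hrW : r X ∈ W G := Submodule.subset_span ⟨X, ⟨hX, hXG⟩, rfl⟩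
    have hφr : Φ G (r X) = 0 := (hΦ G hOG).2 _ hrW
    -- expand `Φ G (r X)` over the coordinates
    have hdec : r X = (∑ i, c X i • ((Pi.single i (1 : F) : ι → F), (0 : F))) + b X • t := by
      refine Prod.ext ?_ ?_
      · funext j
        simp only [hr, ht, Prod.fst_add, Prod.fst_sum, Prod.smul_fst, Pi.add_apply, Finset.sum_apply,
          Pi.smul_apply, Pi.single_apply, smul_eq_mul, mul_ite, mul_one, mul_zero, Pi.zero_apply,
          add_zero]
        rw [Finset.sum_ite_eq]
        simp
      · simp [hr, ht, Prod.snd_sum]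
    have hφexp : Φ G (r X) = (∑ i, c X i * Φ G (Pi.single i 1, 0)) + b X := by
      rw [hdec, map_add, map_sum, map_smul, (hΦ G hOG).1, smul_eq_mul, mul_one]
      congr 1
      exact sum_congr rfl fun i _ => by rw [map_smul, smul_eq_mul]
    -- coordinates with `c X i ≠ 0` are visible, where `θ i` is the common value
    have hsum : ∑ i, c X i * θ i = ∑ i, c X i * Φ G (Pi.single i 1, 0) := by
      refine sum_congr rfl fun i _ => ?_
      by_cases hci : c X i = 0
      · rw [hci, zero_mul, zero_mul]
      · rw [hθ i G hPG hOG (hVis G X i hX hXG hci)]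
    rw [hψ_apply]
    change b X + ∑ i, c X i * θ i = 0
    rw [hsum, add_comm, ← hφexp, hφr]
  -- Step 5: conclude with the main lemma at `H = ker ψ`
  refine sg_of_avoiding_subspace hq0 hq1 r t O hO P (LinearMap.ker ψ) ?_ ?_
  · rw [LinearMap.mem_ker, hψt]
    exact one_ne_zero
  · intro G hPG hOG X hX hXG
    exact (LinearMap.mem_ker).2 (hkill G hPG hOG X hX hXG)

/-- **Pair-local span programs (unknowns on the pairs of vertices).** Unknowns `z_e`, `e : KEdge m`; the
equation of an atom `X` only involves pairs inside `X` (`c X e = 0` unless `e` is live for `X`). If for any two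
`P`-graphs the rows of the commonly present atoms generate, modulo the target, the unit vector of every commonly
present pair, then SG holds for the term gate with `lostPos = ∅` and `gainedNeg ≤ Pr[¬P]`. (Pairs missing from a
graph are invisible to it — the obstruction to the coordinate-free rigidity of the companion file — and are
simply not required here.) [folklore] -/
theorem sg_of_pairLocalSpanProgram :
    ∀ (m l k : ℕ) (q : ℝ), 0 ≤ q → q ≤ 1 →
    ∀ {F : Type} [Field F]
      (c : Finset (Fin m) → KEdge m → F) (b : Finset (Fin m) → F) (O : (KEdge m → Bool) → Bool),
      (∀ x, O x = true ↔ ((0 : KEdge m → F), (1 : F)) ∈ Submodule.span F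
        ((fun X : Finset (Fin m) => (c X, b X)) '' {X | X ∈ smallSets (Fin m) l ∧ CliquePresent X x})) →
      (∀ (X : Finset (Fin m)) (e : KEdge m), ¬ IsLive X e → c X e = 0) →
    ∀ (P : (KEdge m → Bool) → Prop),
      (∀ G G', P G → P G' → ∀ e : KEdge m, G e = true → G' e = true →
        ((Pi.single e (1 : F) : KEdge m → F), (0 : F)) ∈ Submodule.span F
            ((fun X : Finset (Fin m) => (c X, b X)) ''
              {Y | Y ∈ smallSets (Fin m) l ∧ CliquePresent Y G ∧ CliquePresent Y G'})
          ⊔ Submodule.span F {((0 : KEdge m → F), (1 : F))}) →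
      ∃ 𝒜 ⊆ smallSets (Fin m) l,
        lostPos m k O 𝒜 = ∅ ∧ gainedNeg m q O 𝒜 ≤ prob q (fun G => ¬ P G) := by
  intro m l k q hq0 hq1 F _ c b O hO hloc P hrigid
  classical
  refine sg_of_visiblyRigidSpanProgram m l k q hq0 hq1 c b O hO (fun x e => x e = true) ?_ P hrigid
  intro x X e _ hXx hce
  by_contra hxe
  exact hce (hloc X e fun hlive => hxe (hXx e hlive))


/-- **Affinely rigid span-program term gates satisfy SG (torsor version of `sg_of_visiblyRigidSpanProgram`).**
For PARITY-type designs whose rows have zero coordinate sum (e.g. rows `𝟙_{E(K_Y)}` over `𝔽₂` with `C(l,2)`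
even, refuters' worked example in `Cruxes/LinAlgGateBlind/DrefuteG2SGSharpening.md` §2(c)) unit vectors are never
generated, but DIFFERENCES of unit vectors may be. Hypotheses: zero coordinate sums, locality of `Vis`, any three
`P`-graphs see a common coordinate, and pairwise DIFFERENCE rigidity (`(e_i - e_j, 0)` is generated modulo the
target by the rows present in both of two `P`-graphs that both see `i` and `j`). Conclusion: some `𝒜 ⊆ 𝒱(l)` has
`lostPos = ∅` and `gainedNeg ≤ Pr[¬P]`. Proof: the per-graph functionals now agree on commonly visible coordinates
only up to an additive constant `s(G, G')`; constants form a cocycle thanks to triple overlaps, so after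
renormalising at a reference rejected `P`-graph they glue to one global `θ`, and `ψ(v, β) = β + Σ v_i θ_i` kills
every row present in a rejected `P`-graph because the row's coordinates sum to zero. [folklore] -/
theorem sg_of_affinelyRigidSpanProgram :
    ∀ (m l k : ℕ) (q : ℝ), 0 ≤ q → q ≤ 1 →
    ∀ {F ι : Type} [Field F] [Fintype ι] [DecidableEq ι]
      (c : Finset (Fin m) → ι → F) (b : Finset (Fin m) → F) (O : (KEdge m → Bool) → Bool),
      (∀ x, O x = true ↔ ((0 : ι → F), (1 : F)) ∈ Submodule.span F
        ((fun X : Finset (Fin m) => (c X, b X)) '' {X | X ∈ smallSets (Fin m) l ∧ CliquePresent X x})) →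
      (∀ X ∈ smallSets (Fin m) l, ∑ i, c X i = 0) →
    ∀ (Vis : (KEdge m → Bool) → ι → Prop),
      (∀ (x : KEdge m → Bool) (X : Finset (Fin m)) (i : ι),
        X ∈ smallSets (Fin m) l → CliquePresent X x → c X i ≠ 0 → Vis x i) →
    ∀ (P : (KEdge m → Bool) → Prop),
      (∀ G₁ G₂ G₃, P G₁ → P G₂ → P G₃ → ∃ i, Vis G₁ i ∧ Vis G₂ i ∧ Vis G₃ i) →
      (∀ G G', P G → P G' → ∀ i j, Vis G i → Vis G' i → Vis G j → Vis G' j →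
        ((Pi.single i (1 : F) - Pi.single j (1 : F) : ι → F), (0 : F)) ∈ Submodule.span F
            ((fun X : Finset (Fin m) => (c X, b X)) ''
              {Y | Y ∈ smallSets (Fin m) l ∧ CliquePresent Y G ∧ CliquePresent Y G'})
          ⊔ Submodule.span F {((0 : ι → F), (1 : F))}) →
      ∃ 𝒜 ⊆ smallSets (Fin m) l,
        lostPos m k O 𝒜 = ∅ ∧ gainedNeg m q O 𝒜 ≤ prob q (fun G => ¬ P G) := by
  intro m l k q hq0 hq1 F ι _ _ _ c b O hO hsum Vis hVis P htriple hrigid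
  classical
  set r : Finset (Fin m) → (ι → F) × F := fun X => (c X, b X) with hr
  set t : (ι → F) × F := ((0 : ι → F), (1 : F)) with ht
  set W : (KEdge m → Bool) → Submodule F ((ι → F) × F) := fun x =>
    Submodule.span F (r '' {X | X ∈ smallSets (Fin m) l ∧ CliquePresent X x}) with hW
  have hOW : ∀ x, O x = false → t ∉ W x := fun x hx htx => by
    have := (hO x).2 htx
    rw [hx] at this
    exact Bool.false_ne_true this
  -- no rejected `P`-graph: the hyperplane `β = 0` works
  by_cases h0 : ∃ G₀, P G₀ ∧ O G₀ = false
  swap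
  · push Not at h0
    refine sg_of_avoiding_subspace hq0 hq1 r t O hO P
      (LinearMap.ker (LinearMap.snd F (ι → F) F)) ?_ ?_
    · rw [LinearMap.mem_ker, LinearMap.snd_apply, ht]
      exact one_ne_zero
    · intro G hPG hOG
      exact absurd hOG (h0 G hPG)
  obtain ⟨G₀, hP₀, hO₀⟩ := h0
  -- Step 1: a normalised functional per rejected graph
  have hex : ∀ G, ∃ φ : Module.Dual F ((ι → F) × F),
      O G = false → (φ t = 1 ∧ ∀ w ∈ W G, φ w = 0) := by
    intro G
    by_cases hG : O G = false
    · obtain ⟨φ, h1, h2⟩ := exists_dual_eq_one_of_notMem (W G) (hOW G hG)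
      exact ⟨φ, fun _ => ⟨h1, h2⟩⟩
    · exact ⟨0, fun h => absurd h hG⟩
  choose Φ hΦ using hex
  -- Step 2: agreement of DIFFERENCES on commonly visible coordinates
  have hagree : ∀ G₁ G₂, P G₁ → P G₂ → O G₁ = false → O G₂ = false → ∀ i j,
      Vis G₁ i → Vis G₂ i → Vis G₁ j → Vis G₂ j →
      Φ G₁ (Pi.single i 1, 0) - Φ G₁ (Pi.single j 1, 0) =
        Φ G₂ (Pi.single i 1, 0) - Φ G₂ (Pi.single j 1, 0) := by
    intro G₁ G₂ hP₁ hP₂ hO₁ hO₂ i j hi₁ hi₂ hj₁ hj₂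
    have hmem := hrigid G₁ G₂ hP₁ hP₂ i j hi₁ hi₂ hj₁ hj₂
    rw [Submodule.mem_sup] at hmem
    obtain ⟨u, hu, z, hz, huz⟩ := hmem
    obtain ⟨a, rfl⟩ := Submodule.mem_span_singleton.1 hz
    have hboth : Submodule.span F (r '' {Y | Y ∈ smallSets (Fin m) l ∧ CliquePresent Y G₁ ∧
        CliquePresent Y G₂}) ≤ W G₁ ⊓ W G₂ := by
      refine Submodule.span_le.2 ?_
      rintro _ ⟨Y, ⟨hY, hY₁, hY₂⟩, rfl⟩
      exact ⟨Submodule.subset_span ⟨Y, ⟨hY, hY₁⟩, rfl⟩, Submodule.subset_span ⟨Y, ⟨hY, hY₂⟩, rfl⟩⟩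
    have hsplit : ((Pi.single i (1 : F) - Pi.single j (1 : F) : ι → F), (0 : F)) =
        ((Pi.single i (1 : F) : ι → F), (0 : F)) - ((Pi.single j (1 : F) : ι → F), (0 : F)) := by
      ext <;> simp
    have key : ∀ G, O G = false → u ∈ W G →
        Φ G (Pi.single i 1, 0) - Φ G (Pi.single j 1, 0) = a := by
      intro G hOG huG
      have h := congrArg (Φ G) huz
      rw [map_add, (hΦ G hOG).2 u huG, map_smul, (hΦ G hOG).1, smul_eq_mul, mul_one, zero_add,
        hsplit, map_sub] at h
      exact h.symm
    rw [key G₁ hO₁ (hboth hu).1, key G₂ hO₂ (hboth hu).2]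
  -- Step 3: the constants `s G` (offset of `Φ G` against the reference `Φ G₀`)
  have hs : ∀ G, ∃ sG : F, P G → O G = false → ∀ i, Vis G i → Vis G₀ i →
      sG = Φ G (Pi.single i 1, 0) - Φ G₀ (Pi.single i 1, 0) := by
    intro G
    by_cases hG : P G ∧ O G = false
    · obtain ⟨i₀, hi₀, hi₀', -⟩ := htriple G G₀ G₀ hG.1 hP₀ hP₀
      refine ⟨Φ G (Pi.single i₀ 1, 0) - Φ G₀ (Pi.single i₀ 1, 0), fun _ _ i hi hi' => ?_⟩
      have h := hagree G G₀ hG.1 hP₀ hG.2 hO₀ i₀ i hi₀ hi₀' hi hi'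
      -- `Φ G e_{i₀} - Φ G e_i = Φ G₀ e_{i₀} - Φ G₀ e_i`
      linear_combination h
    · exact ⟨0, fun hP hOG => absurd ⟨hP, hOG⟩ hG⟩
  choose s hs using hs
  -- Step 4: one global vector of renormalised coordinate values
  have hθ : ∀ i, ∃ θi : F, ∀ G, P G → O G = false → Vis G i →
      θi = Φ G (Pi.single i 1, 0) - s G := by
    intro i
    by_cases h : ∃ G₁, P G₁ ∧ O G₁ = false ∧ Vis G₁ i
    · obtain ⟨G₁, hP₁, hO₁, hi₁⟩ := h
      refine ⟨Φ G₁ (Pi.single i 1, 0) - s G₁, fun G hP hOG hi => ?_⟩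
      obtain ⟨j, hj₁, hj, hj₀⟩ := htriple G₁ G G₀ hP₁ hP hP₀
      have e1 := hs G₁ hP₁ hO₁ j hj₁ hj₀
      have e2 := hs G hP hOG j hj hj₀
      have h := hagree G₁ G hP₁ hP hO₁ hOG i j hi₁ hi hj₁ hj
      linear_combination h - e1 + e2
    · push Not at h
      exact ⟨0, fun G hP hOG hi => absurd hi (h G hP hOG)⟩
  choose θ hθ using hθ
  -- Step 5: the global functional `ψ (v, β) = β + Σ_i v i * θ i`
  let ψ : ((ι → F) × F) →ₗ[F] F :=
    { toFun := fun v => v.2 + ∑ i, v.1 i * θ i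
      map_add' := fun v w => by
        simp only [Prod.snd_add, Prod.fst_add, Pi.add_apply, add_mul, sum_add_distrib]
        abel
      map_smul' := fun a v => by
        simp only [Prod.smul_snd, Prod.smul_fst, Pi.smul_apply, smul_eq_mul, RingHom.id_apply, mul_add,
          mul_sum, mul_assoc] }
  have hψ_apply : ∀ v : (ι → F) × F, ψ v = v.2 + ∑ i, v.1 i * θ i := fun v => rfl
  have hψt : ψ t = 1 := by
    rw [hψ_apply, ht]
    simp
  have hkill : ∀ G, P G → O G = false → ∀ X ∈ smallSets (Fin m) l, CliquePresent X G → ψ (r X) = 0 := by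
    intro G hPG hOG X hX hXG
    have hrW : r X ∈ W G := Submodule.subset_span ⟨X, ⟨hX, hXG⟩, rfl⟩
    have hφr : Φ G (r X) = 0 := (hΦ G hOG).2 _ hrW
    have hdec : r X = (∑ i, c X i • ((Pi.single i (1 : F) : ι → F), (0 : F))) + b X • t := by
      refine Prod.ext ?_ ?_
      · funext j
        simp only [hr, ht, Prod.fst_add, Prod.fst_sum, Prod.smul_fst, Pi.add_apply, Finset.sum_apply,
          Pi.smul_apply, Pi.single_apply, smul_eq_mul, mul_ite, mul_one, mul_zero, Pi.zero_apply,
          add_zero]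
        rw [Finset.sum_ite_eq]
        simp
      · simp [hr, ht, Prod.snd_sum]
    have hφexp : Φ G (r X) = (∑ i, c X i * Φ G (Pi.single i 1, 0)) + b X := by
      rw [hdec, map_add, map_sum, map_smul, (hΦ G hOG).1, smul_eq_mul, mul_one]
      congr 1
      exact sum_congr rfl fun i _ => by rw [map_smul, smul_eq_mul]
    have hsum' : ∑ i, c X i * θ i = (∑ i, c X i * Φ G (Pi.single i 1, 0)) - (∑ i, c X i) * s G := by
      rw [Finset.sum_mul, ← Finset.sum_sub_distrib]
      refine sum_congr rfl fun i _ => ?_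
      by_cases hci : c X i = 0
      · rw [hci, zero_mul, zero_mul, zero_mul, sub_zero]
      · rw [hθ i G hPG hOG (hVis G X i hX hXG hci), mul_sub]
    rw [hψ_apply]
    change b X + ∑ i, c X i * θ i = 0
    rw [hsum', hsum X hX, zero_mul, sub_zero, add_comm, ← hφexp, hφr]
  refine sg_of_avoiding_subspace hq0 hq1 r t O hO P (LinearMap.ker ψ) ?_ ?_
  · rw [LinearMap.mem_ker, hψt]
    exact one_ne_zero
  · intro G hPG hOG X hX hXG
    exact (LinearMap.mem_ker).2 (hkill G hPG hOG X hX hXG)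

end Summit.PneNP.PneNP.Theorems
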